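import Literature.Analysis.SegalBargmann.FockPkIrreducible
import HarnessLib

set_option autoImplicit false

/-!
# Coefficients of the rational rotation-reflection `mixM i j` on Fock monomials: the UN-MERGE (binomial) step

Topic `Analysis/SegalBargmann`; namespace `Literature.Analysis.SegalBargmann`.  PURE `MvPolynomial` ∕ `coeff` ALGEBRA — no
analysis, no theta series; KERNEL ONLY (theorems, no definition, no named fact, no `sorry`).

Source followed: G. B. Folland, *Harmonic Analysis in Phase Space*, Ch. 4 §5 — the irreducibility of the homogeneous pieces
`𝓟_k ⊂ 𝓕_n` under `U(n)` ("each `𝓟_k` is irreducible under the action of `U(n)`. (We omit the proof of this well-known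
fact …)"), which the tree proves in ★ `FockPkIrreducible` by ONE explicit unitary mixing two coordinates, the real SYMMETRIC
orthogonal involution `mixM i j = 1 ⊕ (3/5, 4/5; 4/5, −3/5)` (★ `FockInvariantLines` §4), and its MERGE step
★ `coeff_merge_linSubst_mixM_zeta_ne_zero : coeff (merge i j α) (ζ_α ∘ mixM) ≠ 0` (all of the `j`-exponent moved onto `i`).
This file adds the converse UN-MERGE step and the bookkeeping a place-by-place ladder consumes:

* §1 `mixM i j` is real symmetric: `(mixM i j)ᵀ = mixM i j`, `star (mixM i j) = mixM i j`, `star (mixU hij) = mixU hij`,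
  `mixU hij * mixU hij = 1` — so the Fock action `F ↦ F ∘ (mixU)⁻¹ = linSubst (star mixU) F` IS `linSubst (mixM i j)`.
* §2 the substitution on variables: `z_i ↦ (3 z_i + 4 z_j)/5`, `z_j ↦ (4 z_i − 3 z_j)/5`, `z_k ↦ z_k` otherwise; it fixes
  `z^{rest i j α}`; `merge i j α i = α_i + α_j`; `merge i j β = merge i j β'` iff-direction «same `(i,j)`-degree, same rest».
* §3 **UN-MERGE**: `coeff β (z^{merge i j β} ∘ mixM) = C(β_i + β_j, β_i) (3/5)^{β_i} (4/5)^{β_j}` (binomial theorem on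
  `((3 z_i + 4 z_j)/5)^{β_i + β_j} · z^{rest}`), hence `coeff β (ζ_{merge i j β} ∘ mixM) ≠ 0`.  With the ★ MERGE step: any two
  multi-indices with the same `(i,j)`-degree and the same exponents off `{i, j}` are linked by TWO mixings with non-zero
  target coefficients (`β ↦ merge i j β = merge i j β' ↦ β'`).
* §4 the finite `ζ`-expansion of any polynomial, `G = Σ_{γ ∈ supp G} (coeff γ G ∕ hcoef γ) • ζ_γ`.
* §5 the ONE-PLACE BRIDGE for block variables `κ × o` (the tree's `Weil1964.placeBlock` ∕ ★ `linSubst_blockDiagonal_mulSingle`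
  convention): `blockDiagonal (mulSingle v (mixM k k')) = mixM (k, v) (k', v)` — the mixing of the two `v`-coordinates `k, k'`
  is the single-place block family of the local mixing, so §2–§3 apply verbatim at one place and never touch another.

WHY (cell `hodgecm-mathlib`, crux `hLiu418` = stmt-HodgeConjecture-24832, line LD1, organ (Gα-C∞) `ArchLadder` of LD1-plan's
`F0LD1ThetaDichotomyOfBricks`, A-p16 (g35)'s plate (P2) «FOCK COEFFICIENTS», DEALS #10-bis): at a DEFINITE real place the compact
`U(2)` acts on the Hermite slice through `h_β ↦ follandFock (ζ_β ∘ W†)`, a finite Hermite combination; the ladder inside one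
`U(W)`-type moves `β` to any `β'` of the same place-degree by the two mixings above and reads off the target Hermite class with a
torus projector — which needs exactly «the target coefficient is non-zero».  HC_CM is proved only modulo the 7 printed citations
until rung 0 closes; this file discharges none of them and no interface fact (a `--supports` helper).

## References
* [Folland1989] G. B. Folland, *Harmonic Analysis in Phase Space*, Annals of Mathematics Studies 122, Princeton University Press,
  1989, Ch. 4 §5 (before Prop. (4.76)) (doi:10.1515/9781400882427).
* J. Igusa, *Theta Functions*, Grundlehren 194, Springer, 1972, pp. 36–37 (the proof Folland refers to).
-/

noncomputable section

open MvPolynomial Matrix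

namespace Literature.Analysis.SegalBargmann

variable {σ : Type*} [Fintype σ] [DecidableEq σ] {i j : σ}

/-! ## §1 `mixM i j` is real symmetric: `star (mixU hij) = mixU hij` -/

omit [Fintype σ] in
/-- The mixing rows are SYMMETRIC: `(mixM i j)_{lk} = (mixM i j)_{kl}`. [cite: Folland1989, Ch. 4 §5 (before Prop. (4.76))] -/
theorem mixRow_symm (hij : i ≠ j) (k l : σ) : mixRow i j l k = mixRow i j k l := by
  by_cases hki : k = i
  · rw [hki, mixRow_apply_i hij l]
    by_cases hli : l = i
    · rw [if_pos hli, hli, mixRow_apply_i hij i, if_pos rfl]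
    · rw [if_neg hli]
      by_cases hlj : l = j
      · rw [if_pos hlj, hlj, mixRow_apply_j hij i, if_pos rfl]
      · rw [if_neg hlj, mixRow_apply_other hij hli hlj i, if_neg (Ne.symm hli)]
  · by_cases hkj : k = j
    · rw [hkj, mixRow_apply_j hij l]
      by_cases hli : l = i
      · rw [if_pos hli, hli, mixRow_apply_i hij j, if_neg (Ne.symm hij), if_pos rfl]
      · rw [if_neg hli]
        by_cases hlj : l = j
        · rw [if_pos hlj, hlj, mixRow_apply_j hij j, if_neg (Ne.symm hij), if_pos rfl]
        · rw [if_neg hlj, mixRow_apply_other hij hli hlj j, if_neg (Ne.symm hlj)]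
    · rw [mixRow_apply_other hij hki hkj l]
      by_cases hli : l = i
      · rw [hli, mixRow_apply_i hij k, if_neg hki, if_neg hkj, if_neg (fun h => hki h.symm)]
      · by_cases hlj : l = j
        · rw [hlj, mixRow_apply_j hij k, if_neg hki, if_neg hkj, if_neg (fun h => hkj h.symm)]
        · rw [mixRow_apply_other hij hli hlj k]
          by_cases hlk : l = k
          · rw [if_pos hlk, if_pos hlk.symm]
          · rw [if_neg hlk, if_neg (fun h => hlk h.symm)]

omit [Fintype σ] in
/-- **`mixM i j` is symmetric**: `(mixM i j)ᵀ = mixM i j`. [cite: Folland1989, Ch. 4 §5 (before Prop. (4.76))] -/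
theorem mixM_transpose (hij : i ≠ j) : (mixM i j : Matrix σ σ ℂ)ᵀ = mixM i j := by
  ext k l
  rw [Matrix.transpose_apply, mixM_apply, mixM_apply, mixRow_symm hij]

omit [Fintype σ] in
/-- **`mixM i j` is self-adjoint** (real symmetric): `star (mixM i j) = mixM i j`. [cite: Folland1989, Ch. 4 §5 (before Prop. (4.76))] -/
theorem star_mixM (hij : i ≠ j) : star (mixM i j : Matrix σ σ ℂ) = mixM i j := by
  ext k l
  rw [Matrix.star_apply, mixM_apply, mixM_apply, star_mixRow_apply hij, mixRow_symm hij]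

/-- **The mixing unitary is self-adjoint**: `star (mixU hij) = mixU hij`; so the Fock action `F ↦ F ∘ (mixU)⁻¹ = linSubst (star ·) F`
of `mixU hij` is the substitution `linSubst (mixM i j)`. [cite: Folland1989, Ch. 4 §5 (before Prop. (4.76))] -/
theorem star_mixU (hij : i ≠ j) : star (mixU hij) = mixU hij :=
  Subtype.ext (star_mixM hij)

/-- `mixU hij` is an involution: `mixU hij * mixU hij = 1`. [cite: Folland1989, Ch. 4 §5 (before Prop. (4.76))] -/
theorem mixU_mul_self (hij : i ≠ j) : mixU hij * mixU hij = 1 := by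
  nth_rw 1 [← star_mixU hij]
  exact Subtype.ext (Matrix.UnitaryGroup.star_mul_self (mixU hij))

/-! ## §2 The substitution on variables; `rest` is fixed; `merge` bookkeeping -/

/-- `z_i ∘ mixM = (3/5) z_i + (4/5) z_j`. [cite: Folland1989, Ch. 4 §5 (before Prop. (4.76))] -/
theorem linSubst_mixM_X_i (i j : σ) :
    linSubst (mixM i j) (X i) = C (3 / 5 : ℂ) * X i + C (4 / 5 : ℂ) * X j := by
  rw [linSubst_X]
  simp_rw [mixM_apply]
  rw [mixRow_i]
  simp_rw [Pi.add_apply, map_add, add_mul]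
  rw [Finset.sum_add_distrib, sum_C_smul_single_mul, sum_C_smul_single_mul]

/-- `z_j ∘ mixM = (4/5) z_i − (3/5) z_j`. [cite: Folland1989, Ch. 4 §5 (before Prop. (4.76))] -/
theorem linSubst_mixM_X_j (hij : i ≠ j) :
    linSubst (mixM i j) (X j) = C (4 / 5 : ℂ) * X i - C (3 / 5 : ℂ) * X j := by
  rw [linSubst_X]
  simp_rw [mixM_apply]
  rw [mixRow_j hij]
  simp_rw [Pi.sub_apply, map_sub, sub_mul]
  rw [Finset.sum_sub_distrib, sum_C_smul_single_mul, sum_C_smul_single_mul]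

/-- `z_k ∘ mixM = z_k` for `k ∉ {i, j}`. [cite: Folland1989, Ch. 4 §5 (before Prop. (4.76))] -/
theorem linSubst_mixM_X_other {k : σ} (hki : k ≠ i) (hkj : k ≠ j) : linSubst (mixM i j) (X k) = X k := by
  rw [linSubst_X]
  simp_rw [mixM_apply]
  rw [mixRow_other hki hkj, ← one_smul ℂ (Pi.single k (1 : ℂ) : σ → ℂ), sum_C_smul_single_mul, C_1, one_mul]

/-- The mixing fixes `z^{rest i j α}` (no `z_i`, `z_j` in it). [cite: Folland1989, Ch. 4 §5 (before Prop. (4.76))] -/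
theorem linSubst_mixM_monomial_rest (i j : σ) (α : σ →₀ ℕ) :
    linSubst (mixM i j) (monomial (rest i j α) 1) = monomial (rest i j α) 1 := by
  rw [monomial_eq, C_1, one_mul, map_finsuppProd]
  refine Finsupp.prod_congr fun n hn => ?_
  have hni : n ≠ i := fun h => Finsupp.mem_support_iff.mp hn (by rw [h, rest_apply_i])
  have hnj : n ≠ j := fun h => Finsupp.mem_support_iff.mp hn (by rw [h, rest_apply_j])
  rw [map_pow, linSubst_mixM_X_other hni hnj]

omit [Fintype σ] in
/-- After merging, the `i`-exponent is `α_i + α_j`. [cite: Folland1989, Ch. 4 §5 (before Prop. (4.76))] -/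
theorem merge_apply_i (i j : σ) (α : σ →₀ ℕ) : merge i j α i = α i + α j := by
  rw [merge, Finsupp.add_apply, Finsupp.single_eq_same, rest_apply_i, add_zero]

omit [Fintype σ] in
/-- **`merge i j` only sees the `(i,j)`-degree and the exponents off `{i, j}`**: two multi-indices with the same `β_i + β_j`
and the same exponents outside `{i, j}` have the same merge. [cite: Folland1989, Ch. 4 §5 (before Prop. (4.76))] -/
theorem merge_eq_merge (hij : i ≠ j) {β β' : σ →₀ ℕ} (hsum : β i + β j = β' i + β' j)
    (hrest : ∀ l, l ≠ i → l ≠ j → β l = β' l) : merge i j β = merge i j β' := by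
  ext l
  by_cases hli : l = i
  · rw [hli, merge_apply_i, merge_apply_i, hsum]
  · by_cases hlj : l = j
    · rw [hlj, merge_apply_j hij, merge_apply_j hij]
    · rw [merge_apply_other hli hlj, merge_apply_other hli hlj, hrest l hli hlj]

/-! ## §3 UN-MERGE: the coefficient of `z^β` in `z^{merge i j β} ∘ mixM` is the binomial `C(β_i+β_j, β_i) (3/5)^{β_i} (4/5)^{β_j}` -/

/-- `z^{merge i j β} ∘ mixM = ((3 z_i + 4 z_j)/5)^{β_i + β_j} · z^{rest i j β}`. [cite: Folland1989, Ch. 4 §5 (before Prop. (4.76))] -/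
theorem linSubst_mixM_monomial_merge (i j : σ) (β : σ →₀ ℕ) :
    linSubst (mixM i j) (monomial (merge i j β) 1) =
      (C (3 / 5 : ℂ) * X i + C (4 / 5 : ℂ) * X j) ^ (β i + β j) * monomial (rest i j β) 1 := by
  rw [merge, monomial_single_add, map_mul, map_pow, linSubst_mixM_X_i, linSubst_mixM_monomial_rest]

omit [Fintype σ] [DecidableEq σ] in
/-- One binomial term, as a monomial: `(a z_i)^k (b z_j)^{m−k} · C(m,k) · z^{r} = z^{k e_i + (m−k) e_j + r} · (a^k b^{m−k} C(m,k))`.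
[cite: Folland1989, Ch. 4 §5 (before Prop. (4.76))] -/
theorem binomialTerm_eq_monomial (a b : ℂ) (m k : ℕ) (r : σ →₀ ℕ) :
    (C a * X i) ^ k * (C b * X j) ^ (m - k) * (m.choose k : MvPolynomial σ ℂ) * monomial r 1 =
      monomial (Finsupp.single i k + Finsupp.single j (m - k) + r) (a ^ k * b ^ (m - k) * (m.choose k : ℂ)) := by
  rw [mul_pow, mul_pow, ← map_pow, ← map_pow, X_pow_eq_monomial, X_pow_eq_monomial, C_mul_monomial, C_mul_monomial,
    mul_one, mul_one, monomial_mul, ← map_natCast (C : ℂ →+* MvPolynomial σ ℂ), C_apply, monomial_mul, add_zero,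
    monomial_mul, mul_one]

/-- **UN-MERGE coefficient** on the bare monomial:
`coeff β (z^{merge i j β} ∘ mixM) = C(β_i + β_j, β_i) · (3/5)^{β_i} (4/5)^{β_j}`. [cite: Folland1989, Ch. 4 §5 (before Prop. (4.76))] -/
theorem coeff_linSubst_mixM_monomial_merge (hij : i ≠ j) (β : σ →₀ ℕ) :
    coeff β (linSubst (mixM i j) (monomial (merge i j β) 1)) =
      (((β i + β j).choose (β i) : ℕ) : ℂ) * ((3 / 5 : ℂ) ^ β i * (4 / 5 : ℂ) ^ β j) := by
  rw [linSubst_mixM_monomial_merge, add_pow, Finset.sum_mul, coeff_sum]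
  simp_rw [binomialTerm_eq_monomial, coeff_monomial]
  rw [Finset.sum_eq_single (β i)]
  · have hidx : Finsupp.single i (β i) + Finsupp.single j (β j) + rest i j β = β := by
      rw [add_assoc]; exact (eq_single_add_single_add_rest hij β).symm
    rw [Nat.add_sub_cancel_left, if_pos hidx]
    ring
  · intro k _ hk
    rw [if_neg]
    intro h
    apply hk
    have hi := DFunLike.congr_fun h i
    simpa [Finsupp.add_apply, Finsupp.single_apply, Ne.symm hij, rest_apply_i] using hi
  · intro h
    exact absurd (Finset.mem_range.2 (by omega)) h

/-- **UN-MERGE coefficient** on the normalised symbols `ζ`: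
`coeff β (ζ_{merge i j β} ∘ mixM) = hcoef (merge i j β) · C(β_i + β_j, β_i) · (3/5)^{β_i} (4/5)^{β_j}`. [cite: Folland1989, Ch. 4 §5 (before Prop. (4.76))] -/
theorem coeff_linSubst_mixM_zeta_merge (hij : i ≠ j) (β : σ →₀ ℕ) :
    coeff β (linSubst (mixM i j) (zeta (merge i j β))) =
      ((hcoef (merge i j β) : ℝ) : ℂ) * ((((β i + β j).choose (β i) : ℕ) : ℂ) * ((3 / 5 : ℂ) ^ β i * (4 / 5 : ℂ) ^ β j)) := by
  rw [zeta, map_smul, coeff_smul, coeff_linSubst_mixM_monomial_merge hij, smul_eq_mul]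

/-- **The UN-MERGE target coefficient is non-zero**: `coeff β (ζ_{merge i j β} ∘ mixM) ≠ 0`.  Together with the ★ MERGE step
`coeff_merge_linSubst_mixM_zeta_ne_zero` and `merge_eq_merge`: two multi-indices with the same `(i,j)`-degree and the same exponents
off `{i, j}` are linked by two mixings with non-zero target coefficients. [cite: Folland1989, Ch. 4 §5 (before Prop. (4.76))] -/
theorem coeff_linSubst_mixM_zeta_merge_ne_zero (hij : i ≠ j) (β : σ →₀ ℕ) :
    coeff β (linSubst (mixM i j) (zeta (merge i j β))) ≠ 0 := by
  rw [coeff_linSubst_mixM_zeta_merge hij]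
  exact mul_ne_zero (Complex.ofReal_ne_zero.mpr (hcoef_pos _).ne')
    (mul_ne_zero (Nat.cast_ne_zero.mpr (Nat.choose_pos (Nat.le_add_right _ _)).ne')
      (mul_ne_zero (pow_ne_zero _ (by norm_num)) (pow_ne_zero _ (by norm_num))))

/-! ## §4 The finite `ζ`-expansion of a polynomial -/

omit [DecidableEq σ] in
/-- **Every polynomial is the finite `ζ`-combination of its coefficients**: `G = Σ_{γ ∈ supp G} (coeff γ G ∕ hcoef γ) • ζ_γ`
(so `ζ_β ∘ mixM`, and its image under any linear `follandFock`-type map, is an explicit FINITE Hermite combination). [cite: Folland1989, Ch. 4 §5 (before Prop. (4.76))] -/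
theorem eq_sum_coeff_smul_zeta (G : MvPolynomial σ ℂ) :
    G = ∑ γ ∈ G.support, (coeff γ G * (((hcoef γ : ℝ) : ℂ))⁻¹) • zeta γ := by
  conv_lhs => rw [G.as_sum]
  refine Finset.sum_congr rfl fun γ _ => ?_
  rw [zeta, smul_smul, mul_assoc, inv_mul_cancel₀ (Complex.ofReal_ne_zero.mpr (hcoef_pos γ).ne'), mul_one, smul_monomial,
    smul_eq_mul, mul_one]

/-! ## §5 ONE-PLACE BRIDGE: the mixing of two coordinates at one place is the single-place block family of the local mixing -/

/-- **`blockDiagonal (mulSingle v (mixM k k')) = mixM (k, v) (k', v)`** on block variables `κ × o` (local variables `κ`, places `o`;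
the tree's `placeBlock` ∕ ★ `linSubst_blockDiagonal_mulSingle` convention): mixing the two `v`-coordinates `k ≠ k'` is the block
family equal to the local mixing `mixM k k'` at `v` and to `1` at every other place. [cite: Folland1989, Ch. 4 §5 (before Prop. (4.76))] -/
theorem blockDiagonal_mulSingle_mixM {κ o : Type*} [DecidableEq κ] [DecidableEq o] (v : o) {k k' : κ} (hkk' : k ≠ k') :
    Matrix.blockDiagonal (Pi.mulSingle v (mixM k k') : o → Matrix κ κ ℂ) = mixM (k, v) (k', v) := by
  have hne : ((k, v) : κ × o) ≠ (k', v) := fun h => hkk' (Prod.ext_iff.mp h).1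
  ext ⟨a, w⟩ ⟨b, w'⟩
  rw [Matrix.blockDiagonal_apply, mixM_apply]
  dsimp only
  by_cases hww' : w = w'
  · rw [if_pos hww', ← hww', Pi.mulSingle_apply]
    by_cases hwv : w = v
    · rw [if_pos hwv, mixM_apply, hwv]
      by_cases hbk : b = k
      · rw [hbk, mixRow_apply_i hkk', mixRow_apply_i hne]
        simp only [Prod.mk.injEq, and_true]
      · by_cases hbk' : b = k'
        · rw [hbk', mixRow_apply_j hkk', mixRow_apply_j hne]
          simp only [Prod.mk.injEq, and_true]
        · rw [mixRow_apply_other hkk' hbk hbk',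
            mixRow_apply_other hne (fun h => hbk (Prod.ext_iff.mp h).1) (fun h => hbk' (Prod.ext_iff.mp h).1)]
          simp only [Prod.mk.injEq, and_true]
    · rw [if_neg hwv, Matrix.one_apply,
        mixRow_apply_other hne (fun h => hwv (Prod.ext_iff.mp h).2) (fun h => hwv (Prod.ext_iff.mp h).2)]
      simp only [Prod.mk.injEq, and_true]
  · rw [if_neg hww']
    by_cases h1 : ((b, w') : κ × o) = (k, v)
    · have hwv : w ≠ v := fun h => hww' (h.trans (Prod.ext_iff.mp h1).2.symm)
      rw [h1, mixRow_apply_i hne, if_neg (fun h => hwv (Prod.ext_iff.mp h).2), if_neg (fun h => hwv (Prod.ext_iff.mp h).2)]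
    · by_cases h2 : ((b, w') : κ × o) = (k', v)
      · have hwv : w ≠ v := fun h => hww' (h.trans (Prod.ext_iff.mp h2).2.symm)
        rw [h2, mixRow_apply_j hne, if_neg (fun h => hwv (Prod.ext_iff.mp h).2), if_neg (fun h => hwv (Prod.ext_iff.mp h).2)]
      · rw [mixRow_apply_other hne h1 h2, if_neg (fun h => hww' (Prod.ext_iff.mp h).2)]

/-- The same at the level of the unitary groups: `(mixU : U(κ × o))` of the two `v`-coordinates has matrix
`blockDiagonal (mulSingle v (mixM k k'))`. [cite: Folland1989, Ch. 4 §5 (before Prop. (4.76))] -/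
theorem coe_mixU_prod_eq_blockDiagonal {κ o : Type*} [Fintype κ] [DecidableEq κ] [Fintype o] [DecidableEq o] (v : o)
    {k k' : κ} (hkk' : k ≠ k') :
    ((mixU (show ((k, v) : κ × o) ≠ (k', v) from fun h => hkk' (Prod.ext_iff.mp h).1) : Matrix.unitaryGroup (κ × o) ℂ) :
        Matrix (κ × o) (κ × o) ℂ) =
      Matrix.blockDiagonal (Pi.mulSingle v (mixM k k') : o → Matrix κ κ ℂ) := by
  rw [coe_mixU, blockDiagonal_mulSingle_mixM v hkk']

end Literature.Analysis.SegalBargmann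

end
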